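import Literature.Computability.AlgebraicComplexity.ObstructionTypes
import HarnessLib

/-!
# Dörfler–Ikenmeyer–Panova: vanishing ideal occurrence obstructions separating power sums from
# the Chow variety (the family `λ = (n²-2, n, 2)`)

Topic `Literature/Computability/AlgebraicComplexity`. Named facts (D-0014) vendoring the infinite
family (1) of the Main Theorem and Prop. 3.3 of J. Dörfler, C. Ikenmeyer, G. Panova, *On geometric
complexity theory: Multiplicity obstructions are stronger than occurrence obstructions*, SIAM J.
Appl. Algebra Geom. 4 (2020) 354–376 = ICALP 2019 = arXiv:1901.04576 (locators are those of the
arXiv version), in the tree's vocabulary.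

DIP's setting (§2, p. 3): `𝔸_m^n = ℂ[x₁,…,x_m]_n`, `V = 𝔸_m^1`, the Chow variety
"`Ch_m^n := {ℓ₁ ⋯ ℓ_n | ℓ_i ∈ V} ⊆ 𝔸_m^n`" and the higher secant variety of the Veronese
"`Pow_{m,k}^n := \overline{{ℓ₁^n + ⋯ + ℓ_k^n | ℓ_i ∈ V}} ⊆ 𝔸_m^n`", with `GL_m` acting on
`ℂ[𝔸_m^n]` by "`(gf)(h) = f(g⁻¹ h)`" (§2, p. 3) and `mult_λ(ℂ[Z]_d)` the multiplicity of type
`λ` in `ℂ[Z]_d = ℂ[𝔸_m^n]_d / I(Z)_d`. RENDERING. The tree speaks of orbit closures of single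
forms (`orbitClosure`, `orbitCoordRep`, `orbitMultiplicity`), so the facts below are stated in the
ORBIT-CLOSURE RANGE `k ≤ m`, `n ≤ m`, where `Ch_m^n = \overline{GL_m · x₁⋯x_n} = Δ_n[x₁ ⋯ x_n]`
and `Pow_{m,k}^n = \overline{GL_m · (x₁^n + ⋯ + x_k^n)} = Δ_n[x₁^n + ⋯ + x_k^n]` (for `n ≤ m`,
resp. `k ≤ m`, every `n`-tuple, resp. `k`-tuple, of linear forms is a limit of linearly
independent tuples, and those are `GL_m`-translates of `(x₁, …, x_n)`, resp. `(x₁, …, x_k)`);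
`x₁ ⋯ x_n ∈ 𝔸_m^n` is `truncatedChowMonomial ℂ n m _` and `x₁^n + ⋯ + x_k^n ∈ 𝔸_m^n` is
`partialPowerSum ℂ k m n _`; `mult_λ(ℂ[Δ_n[f]]_d)` is `orbitMultiplicity ℂ f n (Weight.dualOfPartition m λ)`
and the plethysm coefficient `p_λ(d[n])` (multiplicity of `λ` in `Sym^d Sym^n V`, DIP §2 p. 3) is
`plethysmCoeffOfPartition ℂ m n λ` — the dual-weight convention of `SchurWeylPlethysm.lean` /
`Complexity.partitionWeightLex`, in which the weight pins `d = |λ|/n`. `TODO(general form)`: the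
Main Theorem is stated for all `m ≥ 3`; for `m < n + 1` (in particular the finite settings (2a)
`k=4, n=6, m=3` and (2b) `k=4, n=7, m=4`) `Ch_m^n` and `Pow_{m,k}^n` are not orbit closures of a
form in `m` variables and are not rendered here.

WHAT IS REPRODUCED (verbatim):

* Main Theorem = Thm. 2.3 (1) (p. 4) [`DIP2020_thm_2_3_1`, range `m ≥ n + 1`]: "Let `m ≥ 3`,
  `n ≥ 2`, `k = d = n+1`, `λ = (n²-2, n, 2)`. We have `mult_λ(ℂ[Ch_m^n]_d) < mult_λ(ℂ[Pow_{m,k}^n]_d)`,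
  i.e., `λ` is a multiplicity obstruction that shows `Pow_{m,k}^n ⊄ Ch_m^n`."
* Prop. 3.3 (p. 4) [`DIP2020_prop_3_3`, range `d ≤ k ≤ m`, `n ≥ 1`]: "If `λ` is an `m`-partition
  of `dn` and `k ≥ d`, then `mult_λ(ℂ[Pow_{m,k}^n]_d) = p_λ(d[n])`."

WHAT IS PROVED HERE (kernel): in the range `m ≥ n + 1`, `λ = (n²-2, n, 2)` is a multiplicity
obstruction against `x₁^n + ⋯ + x_{n+1}^n ∈ Δ_n[x₁ ⋯ x_n]` (`dip2020_isMultiplicityObstructionAt`);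
with Prop. 3.3 (`k = d`) it is a VANISHING IDEAL OCCURRENCE obstruction in the sense of
`ObstructionTypes.lean` (`dip2020_isVanishingIdealOccurrenceObstructionAt`; DIP §1: their
obstructions are of this kind, cf. Ikenmeyer–Kandasamy §2); and the separation
`x₁^n + ⋯ + x_{n+1}^n ∉ Δ_n[x₁ ⋯ x_n]` follows by the multiplicity-obstruction principle
(`dip2020_partialPowerSum_not_mem_orbitClosure`).

NOT here: Thm. 2.3 (2a), (2b) and the "no occurrence obstructions" computer verification, Lemma
3.4 (`mult_λ(ℂ[Ch_m^n]_d) ≤ p_λ(n[d])` for `n ≥ m`), Thm. 3.5 (the plethysm inequality), Prop. 5.x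
(occurrence obstructions do exist for small `n`).

## References

* J. Dörfler, C. Ikenmeyer, G. Panova, *On geometric complexity theory: Multiplicity obstructions
  are stronger than occurrence obstructions*, SIAM J. Appl. Algebra Geom. 4 (2020) 354–376;
  arXiv:1901.04576, §2 (Thm. 2.3), §3 (Prop. 3.3). [DorflerIkenmeyerPanova2020]
* P. Bürgisser, C. Ikenmeyer, G. Panova, J. Amer. Math. Soc. 32 (2019), Prop. 3.2 (power sums:
  the source of Prop. 3.3). [BurgisserIkenmeyerPanova2019]

Provenance: pub-gct census cell, LEAN-IN-TREE import of the typed census (toy-model rung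
"multiplicity obstructions are stronger than occurrence obstructions"); PDF pages of
arXiv:1901.04576.
-/

noncomputable section

open MvPolynomial

namespace Literature.Computability.AlgebraicComplexity

open _root_.Literature.NumberTheory.DiophantineGeometry

section Forms

variable (k : Type*) [CommSemiring k]

/-- `x₁ ⋯ x_n` as a form of degree `n` in `m ≥ n` variables (`x_i = X (Fin.castLE _ i)`); its
`GL_m`-orbit closure is DIP's Chow variety `Ch_m^n ⊆ 𝔸_m^n` for `n ≤ m` (file header).
[cite: DorflerIkenmeyerPanova2020, Sec. 2] -/
def truncatedChowMonomial (n m : ℕ) (h : n ≤ m) : MvPolynomial (Fin m) k :=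
  ∏ i : Fin n, X (Fin.castLE h i)

/-- `x₁^n + ⋯ + x_r^n` as a form of degree `n` in `m ≥ r` variables; its `GL_m`-orbit closure is
DIP's `Pow_{m,r}^n ⊆ 𝔸_m^n` (border Waring rank `≤ r`) for `r ≤ m` (file header).
[cite: DorflerIkenmeyerPanova2020, Sec. 2] -/
def partialPowerSum (r m n : ℕ) (h : r ≤ m) : MvPolynomial (Fin m) k :=
  ∑ i : Fin r, X (Fin.castLE h i) ^ n

/-- `x₁ ⋯ x_n` is a form of degree `n`. [folklore] -/
theorem truncatedChowMonomial_isHomogeneous (n m : ℕ) (h : n ≤ m) :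
    (truncatedChowMonomial k n m h).IsHomogeneous n := by
  have hh := IsHomogeneous.prod (Finset.univ : Finset (Fin n))
    (fun i => (X (Fin.castLE h i) : MvPolynomial (Fin m) k)) (fun _ => 1)
    fun i _ => isHomogeneous_X k _
  simpa [truncatedChowMonomial] using hh

/-- `x₁^n + ⋯ + x_r^n` is a form of degree `n`. [folklore] -/
theorem partialPowerSum_isHomogeneous (r m n : ℕ) (h : r ≤ m) :
    (partialPowerSum k r m n h).IsHomogeneous n :=
  IsHomogeneous.sum _ _ _ fun i _ => isHomogeneous_X_pow (Fin.castLE h i) n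

end Forms

/-- DIP's partition `λ = (n²-2, n, 2)` of `(n+1)·n` (`n ≥ 2`; three parts).
[cite: DorflerIkenmeyerPanova2020, Thm. 2.3] -/
def dipPartition (n : ℕ) (hn : 2 ≤ n) : Nat.Partition ((n + 1) * n) :=
  Nat.Partition.ofSums _ {n ^ 2 - 2, n, 2} (by
    obtain ⟨e, rfl⟩ : ∃ e, n = e + 2 := ⟨n - 2, by omega⟩
    have h1 : (e + 2) ^ 2 - 2 = e ^ 2 + 4 * e + 2 := by
      have : (e + 2) ^ 2 = (e ^ 2 + 4 * e + 2) + 2 := by ring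
      rw [this, Nat.add_sub_cancel]
    simp only [Multiset.insert_eq_cons, Multiset.sum_cons, Multiset.sum_singleton, h1]
    ring)

/-- `λ = (n²-2, n, 2)` has at most three (nonzero) parts. [folklore] -/
theorem card_parts_dipPartition_le (n : ℕ) (hn : 2 ≤ n) : (dipPartition n hn).parts.card ≤ 3 := by
  show (Multiset.filter (· ≠ 0) ({n ^ 2 - 2, n, 2} : Multiset ℕ)).card ≤ 3
  exact (Multiset.card_le_card (Multiset.filter_le _ _)).trans (by simp)

/-- NAMED FACT (**Dörfler–Ikenmeyer–Panova 2020, Main Theorem = Thm. 2.3 (1)**, arXiv:1901.04576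
p. 4), in the orbit-closure range `m ≥ n + 1` (file header, `TODO(general form)` for `3 ≤ m ≤ n`):
"Let `m ≥ 3`, `n ≥ 2`, `k = d = n+1`, `λ = (n²-2,n,2)`. We have
`mult_λ(ℂ[Ch_m^n]_d) < mult_λ(ℂ[Pow_{m,k}^n]_d)`, i.e., `λ` is a multiplicity obstruction that shows
`Pow_{m,k}^n ⊄ Ch_m^n`." Here `Ch_m^n = Δ_n[x₁⋯x_n]`, `Pow_{m,n+1}^n = Δ_n[x₁^n + ⋯ + x_{n+1}^n]`
and `mult_λ` is `orbitMultiplicity` at the dual weight of `λ` (which pins `d = n + 1`).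
[cite: DorflerIkenmeyerPanova2020, Thm. 2.3] -/
def DIP2020_thm_2_3_1 : Prop :=
  ∀ (n m : ℕ) (hn : 2 ≤ n) (hm : n + 1 ≤ m),
    orbitMultiplicity ℂ (truncatedChowMonomial ℂ n m ((Nat.le_succ n).trans hm)) n
        (Weight.dualOfPartition m (dipPartition n hn)) <
      orbitMultiplicity ℂ (partialPowerSum ℂ (n + 1) m n hm) n
        (Weight.dualOfPartition m (dipPartition n hn))

/-- NAMED FACT (**Dörfler–Ikenmeyer–Panova 2020, Prop. 3.3**, arXiv:1901.04576 p. 4; from BIP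
2019 Prop. 3.2), in the orbit-closure range `d ≤ k ≤ m` and for `n ≥ 1`: "If `λ` is an
`m`-partition of `dn` and `k ≥ d`, then `mult_λ(ℂ[Pow_{m,k}^n]_d) = p_λ(d[n])`." Here
`Pow_{m,k}^n = Δ_n[x₁^n + ⋯ + x_k^n]`, `mult_λ` is `orbitMultiplicity` at the dual weight of `λ`
and `p_λ(d[n])` is `plethysmCoeffOfPartition ℂ m n λ` (an `m`-partition = at most `m` parts).
[cite: DorflerIkenmeyerPanova2020, Prop. 3.3] -/
def DIP2020_prop_3_3 : Prop :=
  ∀ (n m r d : ℕ) (hr : r ≤ m), 0 < n → d ≤ r →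
    ∀ (lam : Nat.Partition (d * n)), lam.parts.card ≤ m →
      orbitMultiplicity ℂ (partialPowerSum ℂ r m n hr) n (Weight.dualOfPartition m lam) =
        plethysmCoeffOfPartition ℂ m n lam

/-- KERNEL: under Thm. 2.3 (1), for `n ≥ 2` and `m ≥ n + 1`, `λ = (n²-2, n, 2)` is a multiplicity
obstruction against `x₁^n + ⋯ + x_{n+1}^n ∈ Δ_n[x₁ ⋯ x_n]` in the sense of
`IsMultiplicityObstructionAt` ("`λ` is a multiplicity obstruction").
[cite: DorflerIkenmeyerPanova2020, Thm. 2.3] -/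
theorem dip2020_isMultiplicityObstructionAt (h : DIP2020_thm_2_3_1) {n m : ℕ} (hn : 2 ≤ n)
    (hm : n + 1 ≤ m) :
    IsMultiplicityObstructionAt (truncatedChowMonomial ℂ n m ((Nat.le_succ n).trans hm))
      (partialPowerSum ℂ (n + 1) m n hm) n (Weight.dualOfPartition m (dipPartition n hn)) :=
  h n m hn hm

/-- KERNEL: under Thm. 2.3 (1) and Prop. 3.3 (with `k = d = n + 1`), `λ = (n²-2, n, 2)` is a
VANISHING IDEAL OCCURRENCE obstruction against `x₁^n + ⋯ + x_{n+1}^n ∈ Δ_n[x₁ ⋯ x_n]`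
(`mult_λ(ℂ[Ch_m^n]_d) < p_λ(d[n]) = mult_λ(ℂ[Pow_{m,n+1}^n]_d)`), in the sense of
`IsVanishingIdealOccurrenceObstructionAt` — the title claim "multiplicity obstructions are
stronger than occurrence obstructions" is witnessed by obstructions of this kind.
[cite: DorflerIkenmeyerPanova2020, Thm. 2.3] -/
theorem dip2020_isVanishingIdealOccurrenceObstructionAt (h : DIP2020_thm_2_3_1)
    (h33 : DIP2020_prop_3_3) {n m : ℕ} (hn : 2 ≤ n) (hm : n + 1 ≤ m) :
    IsVanishingIdealOccurrenceObstructionAt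
      (truncatedChowMonomial ℂ n m ((Nat.le_succ n).trans hm))
      (partialPowerSum ℂ (n + 1) m n hm) n (Weight.dualOfPartition m (dipPartition n hn)) := by
  have hlt := h n m hn hm
  have heq := h33 n m (n + 1) (n + 1) hm (by omega) le_rfl (dipPartition n hn)
    ((card_parts_dipPartition_le n hn).trans (by omega))
  unfold plethysmCoeffOfPartition at heq
  unfold IsVanishingIdealOccurrenceObstructionAt
  exact ⟨by omega, heq⟩

/-- KERNEL: the separation of Thm. 2.3 (1) in the range `m ≥ n + 1`:
`x₁^n + ⋯ + x_{n+1}^n ∉ Δ_n[x₁ ⋯ x_n]` (i.e. `Pow_{m,n+1}^n ⊄ Ch_m^n`), from the fact and the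
multiplicity-obstruction principle `orbitMultiplicity_le_of_mem_orbitClosure`.
[cite: DorflerIkenmeyerPanova2020, Thm. 2.3] -/
theorem dip2020_partialPowerSum_not_mem_orbitClosure (h : DIP2020_thm_2_3_1)
    (hprin : orbitMultiplicity_le_of_mem_orbitClosure) {n m : ℕ} (hn : 2 ≤ n) (hm : n + 1 ≤ m) :
    partialPowerSum ℂ (n + 1) m n hm ∉
      orbitClosure (truncatedChowMonomial ℂ n m ((Nat.le_succ n).trans hm)) :=
  not_mem_orbitClosure_of_isMultiplicityObstructionAt hprin (by omega)
    (truncatedChowMonomial_isHomogeneous ℂ n m _) (partialPowerSum_isHomogeneous ℂ (n + 1) m n hm)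
    (dip2020_isMultiplicityObstructionAt h hn hm)

end Literature.Computability.AlgebraicComplexity
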